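import Mathlib
import Summits.QuantumAdvantage.QuantumAdvantage.Theses.SelmerBand
import Summits.QuantumAdvantage.QuantumAdvantage.Theorems.SelmerBandBandGlue
import Literature.NumberTheory.EllipticCurves.BSDRankZeroDensity
import Literature.NumberTheory.EllipticCurves.BhargavaShankarSelmerTwoAverageHolds
import HarnessLib

/-!
# Route `SelmerBand`: the support `BandLower` (stmt-QuantumAdvantage-17069) — the Markov half of the band

`BandLower := HeightDensityGE [#Sel₂(E_{A,B}) ≤ 2] (1/3)`: at least a third of elliptic curves
`y² = x³ + Ax + B` (ordered by naive height, the tree's `heightFamilyBelow`) have `#Sel₂ ≤ 2`, in the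
`liminf` sense.  Proof (Bhargava–Shankar, Ann. of Math. 181 (2015), proof of Thm 1.4 from Thm 1.1):
on the family `#Sel₂` is a power of `2` (the tree's `exists_natCard_selmerGroup_eq_pow`, Selmer groups
are finite and killed by `2`), so pointwise `4 − 3·𝟙[#Sel₂ ≤ 2] ≤ #Sel₂`; averaging,
`4 − 3 π_X ≤ Avg_{H<X} #Sel₂ ≤ 3 + ε` eventually, by the tree's PROVED Bhargava–Shankar upper bound
`heightAverageLE_card_selmerTwo_holds` (`limsup Avg #Sel₂ ≤ 3`); hence `π_X ≥ 1/3 − ε/3`.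

* `exists_card_selmerTwo_eq_pow`, `four_sub_le_card_selmerTwo` — the pointwise input (stated for an
  arbitrary `Decidable` instance of the condition, since `heightProportion` uses the classical one);
* `bandLower_proof` — the item, by name (axioms standard).

HONEST FRAMING: a closed support item of a sibling route, NOT summit progress.

## References
* M. Bhargava, A. Shankar, *Binary quartic forms having bounded invariants, and the boundedness of
  the average rank of elliptic curves*, Ann. of Math. 181 (2015), Thm 1.1, Thm 1.4 (arXiv:1006.1002).
-/

set_option linter.dupNamespace false -- D-0017: single-problem summit ⇒ `QuantumAdvantage.QuantumAdvantage` by design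

namespace Summit.QuantumAdvantage.QuantumAdvantage.Theorems.SelmerBand

open Literature.NumberTheory.EllipticCurves Filter

/-- On the family, `#Sel₂(E_{A,B})` is a power of `2`. [folklore] -/
theorem exists_card_selmerTwo_eq_pow {AB : ℤ × ℤ} (h : IsInHeightFamily AB) :
    ∃ s : ℕ, Nat.card ((shortWeierstrass AB).selmerGroup 2) = 2 ^ s := by
  haveI := isElliptic_shortWeierstrass h
  haveI : Fact (Nat.Prime 2) := ⟨Nat.prime_two⟩
  exact exists_natCard_selmerGroup_eq_pow (shortWeierstrass AB) 2

/-- Pointwise Markov input: `4 − 3·𝟙[#Sel₂ ≤ 2] ≤ #Sel₂` on the family (`#Sel₂ ∈ {1, 2, 4, 8, …}`);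
stated for an arbitrary `Decidable` instance of the condition (the route's `heightProportion` uses the
classical one). [folklore] -/
theorem four_sub_le_card_selmerTwo {AB : ℤ × ℤ} (h : IsInHeightFamily AB)
    (d : Decidable (Nat.card ((shortWeierstrass AB).selmerGroup 2) ≤ 2)) :
    (4 : ℝ) - 3 * (@ite ℝ (Nat.card ((shortWeierstrass AB).selmerGroup 2) ≤ 2) d 1 0) ≤
      (Nat.card ((shortWeierstrass AB).selmerGroup 2) : ℝ) := by
  obtain ⟨s, hs⟩ := exists_card_selmerTwo_eq_pow h
  split_ifs with hle
  · rw [hs]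
    have : (1 : ℝ) ≤ ((2 ^ s : ℕ) : ℝ) := by exact_mod_cast Nat.one_le_two_pow
    linarith
  · rw [hs] at hle ⊢
    have hs2 : 2 ≤ s := by
      by_contra hs1
      push Not at hs1
      interval_cases s <;> simp at hle
    have h4 : (4 : ℕ) ≤ 2 ^ s := by
      calc (4 : ℕ) = 2 ^ 2 := by norm_num
        _ ≤ 2 ^ s := Nat.pow_le_pow_right (by norm_num) hs2
    have : (4 : ℝ) ≤ ((2 ^ s : ℕ) : ℝ) := by exact_mod_cast h4
    linarith

/-! ### `BandLower` (stmt-QuantumAdvantage-17069) -/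

/-- **`SelmerBand.BandLower`** (the Markov half): from the tree's Bhargava–Shankar theorem
`heightAverageLE_card_selmerTwo_holds` (`limsup Avg #Sel₂ ≤ 3`) and `4 − 3·𝟙[#Sel₂ ≤ 2] ≤ #Sel₂`
pointwise (`#Sel₂` is a power of `2`), the proportion of curves with `#Sel₂ ≤ 2` has lower density
`≥ 1/3`: `4 − 3 π_X ≤ Avg #Sel₂ ≤ 3 + ε`. [cite: BhargavaShankarAnnals2015, Thm 1.1] [folklore] -/
theorem bandLower_proof : Summit.QuantumAdvantage.QuantumAdvantage.Theses.SelmerBand.BandLower := by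
  intro ε hε
  have hBS := heightAverageLE_card_selmerTwo_holds ε hε
  filter_upwards [hBS, eventually_ge_atTop 5] with X hX hX5
  have hcard := card_heightFamilyBelow_pos hX5
  have hc : (0 : ℝ) < ((heightFamilyBelow X).card : ℝ) := by exact_mod_cast hcard
  unfold heightProportion
  unfold heightAverage at hX ⊢
  dsimp only at hX ⊢
  rw [div_le_iff₀ hc] at hX
  rw [le_div_iff₀ hc]
  -- sum the pointwise inequality over the family, against the goal's own indicator
  have key : ∀ g : ℤ × ℤ → ℝ,
      (∀ AB ∈ heightFamilyBelow X,
        (4 : ℝ) - 3 * g AB ≤ (Nat.card ((shortWeierstrass AB).selmerGroup 2) : ℝ)) →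
      (1 / 3 - ε) * ((heightFamilyBelow X).card : ℝ) ≤ ∑ AB ∈ heightFamilyBelow X, g AB := by
    intro g hg
    have hpt := Finset.sum_le_sum hg
    rw [Finset.sum_sub_distrib, Finset.sum_const, nsmul_eq_mul, ← Finset.mul_sum] at hpt
    have hεc : 0 ≤ ε * ((heightFamilyBelow X).card : ℝ) := mul_nonneg hε.le hc.le
    linarith
  exact key _ fun AB hAB =>
    four_sub_le_card_selmerTwo ((mem_heightFamilyBelow_iff AB X).mp hAB).1 _


end Summit.QuantumAdvantage.QuantumAdvantage.Theorems.SelmerBand
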